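import Summits.HubbardSuperconductivity.HubbardSuperconductivity.Theorems.AnisotropyChordTransferFibre3RowCLamIncrement
import Summits.HubbardSuperconductivity.HubbardSuperconductivity.Theorems.AnisotropyChordTransferFibre3GeomGMin
import Summits.HubbardSuperconductivity.HubbardSuperconductivity.Theorems.AnisotropyChordTransferFibre3ShellTermBounds

/-!
# Route `AnisotropyChord` / H0 rotor rung: PartN41-C §2 — termwise ingredients for an L-UNIFORM G-MIN constant

Elementary bounds feeding the L-uniform G-min constant (theory-1 g22 PartN41-C §2 `GminUniform`, port …Fibre3KT2bRow; the
constant landed in …RowCGmin is the provable `0.07 + 0.1ν`, the typed `0.064 + 0.1ν` sitting only 1.5 % above the GeomGMin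
value): ★ `exp_neg_le_of_sum` (`e^{−a} ≤ 1/S` for a Taylor partial sum `S ≤ e^a`) and the three numerical instances,
★ `one_sub_pow_le_exp`, `one_add_pow_le_exp`, ★ `exp_sub_one_le` (`eˣ − 1 ≤ x + ¾x²`), ★ `exp_small_le` (`eˣ ≤ 1 + x + x²`),
★ `eps1_ge_sharp` (`ε₁ ≥ 0.9997·θ²/2`, `L ≥ 128`), and the generic per-momentum bound ★ `geom_term_le`:
`((4 − ε_k)/c₀)^{n₀} g_k ≤ e^{−(V/3 − 1)(E − λ/2)/4}/(2E − λ)` for any `λ/2 < E ≤ ε_k`.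
Prover seat `hubbard-h0-rotor-p1` g27 (route lead); helper for stmt-HubbardSuperconductivity-23918 (`--supports`, helper class).
WHAT THIS IS NOT: nothing here proves superconductivity in the Hubbard model.  Tree imports only; no new definitions; no sorry.
-/

set_option linter.dupNamespace false
set_option autoImplicit false

noncomputable section

open scoped BigOperators

namespace Summit.HubbardSuperconductivity.HubbardSuperconductivity.Theorems.AnisotropyChord.Transfer.Fibre3

namespace RowC

open RateLemma

/-! ## §1 Exponential numerics -/

/-- `e^{−a} ≤ 1/S` whenever `S ≤ Σ_{i<n} aⁱ/i!` and `0 ≤ a`, `0 < S`. [folklore] -/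
theorem exp_neg_le_of_sum (a S : ℝ) (ha : 0 ≤ a) (hS : 0 < S) (n : ℕ)
    (h : S ≤ ∑ i ∈ Finset.range n, a ^ i / (i.factorial : ℝ)) : Real.exp (-a) ≤ 1 / S := by
  have h1 : S ≤ Real.exp a := h.trans (Real.sum_le_exp_of_nonneg ha n)
  rw [Real.exp_neg, ← one_div]
  exact one_div_le_one_div_of_le hS h1

/-- `e^{−1.644} ≤ 0.19325`. [folklore] -/
theorem exp_neg_1644 : Real.exp (-1.644) ≤ 0.19325 := by
  have h := exp_neg_le_of_sum 1.644 5.1749 (by norm_num) (by norm_num) 14 (by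
    simp only [Finset.sum_range_succ, Finset.sum_range_zero, Nat.factorial]
    norm_num)
  exact h.trans (by norm_num)

/-- `e^{−3.288} ≤ 0.037341`. [folklore] -/
theorem exp_neg_3288 : Real.exp (-3.288) ≤ 0.037341 := by
  have h := exp_neg_le_of_sum 3.288 26.7803 (by norm_num) (by norm_num) 20 (by
    simp only [Finset.sum_range_succ, Finset.sum_range_zero, Nat.factorial]
    norm_num)
  exact h.trans (by norm_num)

/-- `e^{−3.04} ≤ 0.04791`. [folklore] -/
theorem exp_neg_304 : Real.exp (-3.04) ≤ 0.04791 := by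
  have h := exp_neg_le_of_sum 3.04 20.877 (by norm_num) (by norm_num) 18 (by
    simp only [Finset.sum_range_succ, Finset.sum_range_zero, Nat.factorial]
    norm_num)
  exact h.trans (by norm_num)

/-- `(1 − y)ⁿ ≤ e^{−ny}` for `y ≤ 1`. [folklore] -/
theorem one_sub_pow_le_exp (y : ℝ) (hy1 : y ≤ 1) (n : ℕ) :
    (1 - y) ^ n ≤ Real.exp (-((n : ℝ) * y)) := by
  have h1 : 1 - y ≤ Real.exp (-y) := Real.one_sub_le_exp_neg y
  have h2 : (1 - y) ^ n ≤ Real.exp (-y) ^ n := pow_le_pow_left₀ (by linarith) h1 n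
  rw [← Real.exp_nat_mul] at h2
  have e : (n : ℝ) * -y = -((n : ℝ) * y) := by ring
  rwa [e] at h2

/-- `(1 + t)ⁿ ≤ e^{nt}` for `0 ≤ t`. [folklore] -/
theorem one_add_pow_le_exp (t : ℝ) (ht : 0 ≤ t) (n : ℕ) : (1 + t) ^ n ≤ Real.exp ((n : ℝ) * t) := by
  have h1 : 1 + t ≤ Real.exp t := by have := Real.add_one_le_exp t; linarith
  have h2 : (1 + t) ^ n ≤ Real.exp t ^ n := pow_le_pow_left₀ (by linarith) h1 n
  rwa [← Real.exp_nat_mul] at h2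

/-- `eˣ − 1 ≤ x + ¾x²` for `0 ≤ x ≤ 1`. [folklore] -/
theorem exp_sub_one_le (x : ℝ) (h0 : 0 ≤ x) (h1 : x ≤ 1) : Real.exp x - 1 ≤ x + 3 / 4 * x ^ 2 := by
  have h := Real.exp_bound (show |x| ≤ 1 by rw [abs_of_nonneg h0]; exact h1) (show 0 < 2 by norm_num)
  simp only [Finset.sum_range_succ, Finset.sum_range_zero, Nat.factorial] at h
  norm_num at h
  have := (abs_le.mp h).2
  linarith

/-- `eˣ ≤ 1 + x + x²` for `|x| ≤ 1`. [folklore] -/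
theorem exp_small_le (x : ℝ) (hx : |x| ≤ 1) : Real.exp x ≤ 1 + x + x ^ 2 := by
  have := (abs_le.mp (Real.abs_exp_sub_one_sub_id_le hx)).2
  linarith

/-! ## §2 The sharp first-shell energy -/

/-- `ε₁ ≥ 0.9997·θ²/2` for `L ≥ 128` (`cos x ≤ 1 − x²/2 + (5/96)x⁴`). [folklore] -/
theorem eps1_ge_sharp (L : ℕ) [NeZero L] (hL : 128 ≤ L) :
    0.9997 * ((2 * Real.pi / L) ^ 2 / 2) ≤ eps1 L := by
  have hLpos : (0 : ℝ) < L := by exact_mod_cast (show 0 < L by omega)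
  have hL128 : (128 : ℝ) ≤ L := by exact_mod_cast hL
  have hπ := Real.pi_lt_d2
  set θ : ℝ := 2 * Real.pi / L with hθ
  have hθpos : 0 < θ := by positivity
  have hθle : θ ≤ 0.05 := by
    rw [hθ, div_le_iff₀ hLpos]; nlinarith
  have hcb := Real.cos_bound (show |θ| ≤ 1 by rw [abs_of_pos hθpos]; linarith)
  rw [abs_of_pos hθpos] at hcb
  have hc : Real.cos θ ≤ 1 - θ ^ 2 / 2 + θ ^ 4 * (5 / 96) := by
    have := (abs_le.mp hcb).2; linarith
  unfold eps1
  rw [← hθ]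
  have hθ2 : θ ^ 2 ≤ 0.0025 := by nlinarith
  nlinarith [sq_nonneg θ, pow_pos hθpos 4]

/-! ## §3 The generic per-momentum bound -/

/-- ★ for `k ≠ 0` and any `λ/2 < E ≤ ε(k)`:
`((4 − ε_k)/(4 − λ/2))^{n₀}·g_k ≤ e^{−n⁻(E − λ/2)/4}/(2E − λ)` whenever `n⁻ ≤ n₀` (`0 < λ ≤ 1`). [folklore] -/
theorem geom_term_le (L : ℕ) [NeZero L] {lam2 : ℝ} (hl0 : 0 < lam2) (hl1 : lam2 ≤ 1) {k : Tor L} (hk : k ≠ 0)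
    (E : ℝ) (hEl : lam2 / 2 < E) (hE : E ≤ epsT L k) (n0 : ℕ) (nlo : ℝ) (hnlo : nlo ≤ n0) :
    ((4 - epsT L k) / (4 - lam2 / 2)) ^ n0 * gres L lam2 k
      ≤ Real.exp (-(nlo * (E - lam2 / 2) / 4)) / (2 * E - lam2) := by
  have hε4 : epsT L k ≤ 4 := epsT_le_four L k
  have hc0 : 0 < 4 - lam2 / 2 := by linarith
  have hg : gres L lam2 k = 1 / (2 * epsT L k - lam2) := by unfold gres; rw [if_neg hk]
  have hden : 0 < 2 * E - lam2 := by linarith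
  have hdenk : 0 < 2 * epsT L k - lam2 := by linarith
  -- the base as `1 − y`
  set y : ℝ := (epsT L k - lam2 / 2) / (4 - lam2 / 2) with hy
  have hbase : (4 - epsT L k) / (4 - lam2 / 2) = 1 - y := by
    rw [hy, eq_sub_iff_add_eq, ← add_div, show 4 - epsT L k + (epsT L k - lam2 / 2) = 4 - lam2 / 2 by ring,
      div_self hc0.ne']
  have hy0 : 0 ≤ y := by rw [hy]; apply div_nonneg <;> linarith
  have hy1 : y ≤ 1 := by rw [hy, div_le_one hc0]; linarith
  have h1 := one_sub_pow_le_exp y hy1 n0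
  -- `n₀ y ≥ n⁻ (E − λ/2)/4`
  have hy' : (E - lam2 / 2) / 4 ≤ y := by
    rw [hy, div_le_div_iff₀ (by norm_num) hc0]; nlinarith
  have h2 : nlo * (E - lam2 / 2) / 4 ≤ (n0 : ℝ) * y := by
    have : nlo * ((E - lam2 / 2) / 4) ≤ (n0 : ℝ) * y :=
      mul_le_mul hnlo hy' (by linarith) (by positivity)
    linarith
  have h3 : (1 - y) ^ n0 ≤ Real.exp (-(nlo * (E - lam2 / 2) / 4)) :=
    h1.trans (Real.exp_le_exp.mpr (by linarith))
  rw [hbase, hg]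
  have h4 : 1 / (2 * epsT L k - lam2) ≤ 1 / (2 * E - lam2) := one_div_le_one_div_of_le hden (by linarith)
  calc (1 - y) ^ n0 * (1 / (2 * epsT L k - lam2))
      ≤ Real.exp (-(nlo * (E - lam2 / 2) / 4)) * (1 / (2 * E - lam2)) :=
        mul_le_mul h3 h4 (by positivity) (by positivity)
    _ = Real.exp (-(nlo * (E - lam2 / 2) / 4)) / (2 * E - lam2) := by ring

/-! ## §4 The first (geometric) term of `GeomGMin` -/

/-- ★ `½Σ_{n<n₀} 4ⁿ/(c₀^{n+1}V) = ((4/c₀)^{n₀} − 1)/(λV)` and its bound `≤ (x + ¾x²)/(λV)`, `x = n₀λ/(2c₀)` (`x ≤ 1`). [folklore] -/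
theorem first_term_le (V lam2 : ℝ) (hV : 0 < V) (hl0 : 0 < lam2) (hl1 : lam2 ≤ 1) (n0 : ℕ)
    (hx : (n0 : ℝ) * (lam2 / 2 / (4 - lam2 / 2)) ≤ 1) :
    (1 / 2 : ℝ) * (∑ n ∈ Finset.range n0, (4 : ℝ) ^ n / ((4 - lam2 / 2) ^ (n + 1) * V))
      ≤ ((n0 : ℝ) * (lam2 / 2 / (4 - lam2 / 2)) + 3 / 4 * ((n0 : ℝ) * (lam2 / 2 / (4 - lam2 / 2))) ^ 2)
          / (lam2 * V) := by
  set c0 : ℝ := 4 - lam2 / 2 with hc0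
  have hc0pos : 0 < c0 := by rw [hc0]; linarith
  set r : ℝ := 4 / c0 with hr
  have hr1 : r = 1 + lam2 / 2 / c0 := by
    have e : c0 + lam2 / 2 = 4 := by rw [hc0]; ring
    rw [hr, ← e, add_div, div_self hc0pos.ne']
  have ht0 : 0 < lam2 / 2 / c0 := by positivity
  have hrne : r ≠ 1 := by rw [hr1]; linarith
  -- rewrite the summand and sum the geometric series
  have e1 : ∀ n : ℕ, (4 : ℝ) ^ n / (c0 ^ (n + 1) * V) = (1 / (c0 * V)) * r ^ n := by
    intro n; rw [hr, div_pow, pow_succ]; field_simp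
  rw [Finset.sum_congr rfl fun n _ => e1 n, ← Finset.mul_sum, geom_sum_eq hrne]
  have e2 : r - 1 = lam2 / 2 / c0 := by rw [hr1]; ring
  rw [e2]
  -- `(4/c₀)^{n₀} − 1 ≤ e^x − 1 ≤ x + ¾x²`
  set x : ℝ := (n0 : ℝ) * (lam2 / 2 / c0) with hxdef
  have hx0 : 0 ≤ x := by positivity
  have hpow : r ^ n0 ≤ Real.exp x := by
    rw [hr1, hxdef]; exact one_add_pow_le_exp _ ht0.le n0
  have hnum : r ^ n0 - 1 ≤ x + 3 / 4 * x ^ 2 := by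
    have := exp_sub_one_le x hx0 hx
    linarith
  have e3 : (1 / 2 : ℝ) * (1 / (c0 * V) * ((r ^ n0 - 1) / (lam2 / 2 / c0))) = (r ^ n0 - 1) / (lam2 * V) := by
    field_simp
  rw [e3]
  exact div_le_div_of_nonneg_right hnum (by positivity)

end RowC

end Summit.HubbardSuperconductivity.HubbardSuperconductivity.Theorems.AnisotropyChord.Transfer.Fibre3

end
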